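import Summits.CriticalPhenomena.Ising3DConformalLimit.Theorems.HyperoctahedralRPExistsScaleCovariantLimitFoldedCurrentDefs
import Summits.CriticalPhenomena.Ising3DConformalLimit.Theorems.HyperoctahedralRPExistsScaleCovariantLimitFoldedCurrentUniquenessClusterSet
import Summits.CriticalPhenomena.Ising3DConformalLimit.Theorems.HyperoctahedralRPExistsScaleCovariantLimitFoldedCurrentUniquenessLevelDistances
import Summits.CriticalPhenomena.Ising3DConformalLimit.Theorems.HyperoctahedralRPExistsScaleCovariantLimitFoldedCurrentUniquenessScaleRedundancy
import Summits.CriticalPhenomena.Ising3DConformalLimit.Theorems.HyperoctahedralRPExistsScaleCovariantLimitCruxIffOrbitPrecompactPointwiseLimit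
import Summits.CriticalPhenomena.Ising3DConformalLimit.Theorems.HyperoctahedralRPExistsScaleCovariantLimitCompactnessItemMapsDoubling
import Summits.CriticalPhenomena.Ising3DConformalLimit.Theses.ClusterRigidity
import HarnessLib

/-!
# F4 `stub_clusterPointUnique` — the uniqueness half of the crux IS item 4659 given item 5955
# (crux `ExistsScaleCovariantLimit`, item stmt-CriticalPhenomena-1981, line `folded-current-repulsion`)

Route `HyperoctahedralRP` / `GaussianScaleMixture` (sub-problem `CriticalPhenomena/Ising3DConformalLimit`), crux
`Summit.CriticalPhenomena.Ising3DConformalLimit.Theses.HyperoctahedralRP.ExistsScaleCovariantLimit` (item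
stmt-CriticalPhenomena-1981). The registered stub `stub_clusterPointUnique : ClusterPointUnique` of the checked skeleton
`Cruxes/ExistsScaleCovariantLimit/Lines/folded_current_repulsion.lean` (statement in the landed definitions module
`Theorems/HyperoctahedralRPExistsScaleCovariantLimitFoldedCurrentDefs.lean`),

  `ClusterPointUnique := ∀ S S', IsClusterPoint S → IsClusterPoint S' → ∀ n, EqOn (S n) (S' n) (NonCoincident 3 n)`

(any two locally uniform cluster points of the pinned zoom `ρ_pin(δ)ⁿ ⟨∏ᵢ σ_{[xᵢ/δ]}⟩_{β_c}` of the critical `ℤ³` Ising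
correlators agree off the diagonals), is the UNIQUENESS HALF of an open problem (H. Duminil-Copin, ICM 2022, §8.4:
existence of the scaling limit of the critical 3D Ising correlations is "widely open"). This file does NOT prove it; it
lands, kernel-checked, the REDUCTION of the stub to an EXISTING item of another route, given the compactness half that
the line's engine `stub_wallRepulsion` (⟺ item 6150) supplies:

* `clusterPointUnique_of_orbitPrecompact_of_totallyDisconnected` (registered sub-goal of the line) — **item 5955
  `MonotoneRG.OrbitPrecompact` ∧ item 4659 `ClusterRigidity.ClusterSetTotallyDisconnected` ⟹ `ClusterPointUnique`**;
* `clusterSetTotallyDisconnected_of_clusterPointUnique` — **`ClusterPointUnique` ⟹ item 4659**, unconditionally; hence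
  `clusterPointUnique_iff_clusterSetTotallyDisconnected` — **under item 5955 the stub IS item 4659**;
* `clusterPointUnique_of_doubling_of_totallyDisconnected` — item 6150 ∧ item 4659 ⟹ the stub (the form the skeleton's
  composition consumes: 6150 ⟺ 5955, `orbitPrecompact_iff_doubling`, p120504);
* `crux_iff_doubling_and_totallyDisconnected` — **THE CRUX ⟺ item 6150 `TwoPointDoubling` ∧ item 4659
  `ClusterSetTotallyDisconnected`**: the crux-strategist's split `crux ⟺ TwoPointDoubling ∧ ClusterPointUnique`
  (`STRATEGY-CENSUS.md` §Decomposition) with its second child identified with an item already on the ledger;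
* `clusterPointUnique_of_pointwiseLimit` (item 6153 ⟹ the stub; the landed `clusterPoint_eqOn_of_pointwiseLimit`) and
  `clusterPointUnique_of_crux` (crux ⟹ the stub; `crux_iff_orbitPrecompact_and_unique`, p78620) — by-name handles.

## The argument (elementary topology; route `ClusterRigidity`'s assembly "connected inside totally disconnected")

Three support files (namespace `…FoldedCurrentRepulsion.Uniqueness`). (A) `…FoldedCurrentUniquenessClusterSet.lean`
(abstract, any type with a countable non-decreasing family of pseudo-metrics `D j`): the cluster set of a sequence that
is TIGHT (every subsequence has a `D`-convergent subsequence) and ASYMPTOTICALLY CONTINUOUS (`D j (y m) (y (m+1)) → 0`)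
is sequentially compact and admits no partition into two nonempty parts closed under limits from the cluster set
(`clusterSet_partition_false` — the classical proof that `ω`-limit sets of asymptotically slow precompact orbits are
connected). (B) `…FoldedCurrentUniquenessLevelDistances.lean`: on `CorrFamily 3` the level distances `lD j` (sums over
`n, i ≤ j` of truncated sup-distances on compact pieces exhausting `NonCoincident 3 n`) metrise locally uniform
convergence off the diagonals for all orders at once (`exists_levelDist`). (C) `…FoldedCurrentUniquenessScaleRedundancy.lean`
(the pinned zoom; inputs: item 5955 via the landed `tight_of_orbitPrecompact`, the exact re-pinning identity
`pz_scale`, the automatic continuity of sequential limits `continuousOn_seqLimit`, the pinning `clusterPoint_cfg01`):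
tightness along every `u_k → 0⁺` (`tight_nhdsGT`); ASYMPTOTIC SCALE REDUNDANCY — a limit along `u_k` is the limit along
every `w_k` with `u_k/w_k → 1` (`tluo_of_ratio`); hence every cluster point is a cluster point along the harmonic meshes
`1/(m+1)` (`exists_harmonic_subseq`). HERE: the harmonic zoom, normalised (set to zero off `NonCoincident`), is a
tight, asymptotically continuous sequence for the level distances, whose cluster set, normalised, lies in the set of
item 4659 and contains the normalisation of every cluster point; if two cluster points differed after normalisation,
total disconnectedness would separate that set by two open sets of the product topology, and pulling the separation
back gives a forbidden partition (the parts are closed under level limits because level convergence of normalised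
families implies convergence in the product topology).

## Junk audit of the stub as typed (recorded for the lead; nothing here is used below)

* `n = 0`: `criticalCorr 3 0 ≡ 1` (`criticalCorr_arity_zero`; `plusExpect_one`), so `S 0 ≡ 1` for every cluster point.
* odd `n`: `criticalCorr 3 n ≡ 0` (`criticalCorr_eq_zero_of_odd`, from `m*(β_c) = 0` on `ℤ³`), so `S n ≡ 0` off the
  diagonals for every cluster point. `n = 2` at the pinned pair: `S 2 (0, e₀) = 1` (`clusterPoint_cfg01`).
  Hence the stub is automatic at orders `0`, odd, and at the pinned pair; its content is at even orders `n ≥ 2`.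
* no sign / scale ambiguity: pinning fixes `S 2 (0,e₀) = 1` and `S 2 ≥ 0` (`clusterPoint_two_nonneg`, Griffiths);
  every cluster point is continuous off the diagonals (`continuousOn_of_isClusterPoint`), translation invariant
  (`seqLimit_translate`) and inherits the lattice symmetries and two-point comparison bounds — none of which pins it.
* not refutable short of refuting the crux (`clusterPointUnique_of_crux`); not vacuous under item 5955 (cluster points
  exist); without 5955 it may hold vacuously along scales where the zoom diverges, which is why it does NOT imply item
  6150 (census §Decomposition); consistent with Disproof v8 §E (`W_ε`: two-point axiomatics admit two cluster points).

References: H. Duminil-Copin, *100 years of the (critical) Ising model on the hypercubic lattice*, ICM 2022, §8.4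
[DuminilCopinICM2022]; S. Rychkov, *3D Ising model: a view from the conformal bootstrap island*, C. R. Physique 21
(2020), p. 8 (isolation of local CFTs, the intended engine of item 4659) [Rychkov2020]. The topology is folklore
(H. L. Smith, *Monotone Dynamical Systems*, AMS 1995, §1.1: connectedness of `ω`-limit sets). No `sorry`, no
definitions, no propositions defined.
-/

noncomputable section

namespace Summit.CriticalPhenomena.Ising3DConformalLimit.Cruxes.ExistsScaleCovariantLimit.FoldedCurrentRepulsion

open Filter Set
open scoped Topology

/-! ## Part D. The reduction of the stub to item 4659, and the item maps of the uniqueness half -/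

section Main

open Literature.Probability.LatticeModels
open Summit.CriticalPhenomena.Ising3DConformalLimit.MoebiusLimitExistsOnlyInteraction (rhoPin IsClusterPoint)
open Summit.CriticalPhenomena.Ising3DConformalLimit.Theses
open Summit.CriticalPhenomena.Ising3DConformalLimit.MoebiusLimitExistsNegative (tendsto_div_succ_nhdsGT)
open Summit.CriticalPhenomena.Ising3DConformalLimit.ExistsScaleCovariantLimitNegative
  (one_div_succ_mem_Ioc crux_iff_orbitPrecompact_and_unique)
open Summit.CriticalPhenomena.Ising3DConformalLimit.Cruxes.ExistsScaleCovariantLimit.TwoHierarchies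
  (rhoStar_eq_rhoPin clusterPoint_eqOn_of_pointwiseLimit)
open Summit.CriticalPhenomena.Ising3DConformalLimit.Cruxes.ExistsScaleCovariantLimit.TwoHierarchies.ItemMaps
  (orbitPrecompact_iff_doubling)
open Uniqueness

/-- **ITEM 5955 ∧ ITEM 4659 ⟹ UNIQUENESS OF THE PINNED CLUSTER POINT** (registered sub-goal
`clusterPointUnique_of_orbitPrecompact_of_totallyDisconnected` of line `folded-current-repulsion`). Under precompactness
of the critical zoom orbit (`MonotoneRG.OrbitPrecompact`, item stmt-CriticalPhenomena-5955 ⟺ item 6150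
`TwoPointDoubling`), total disconnectedness of the cluster set of the self-normalised critical correlators
(`ClusterRigidity.ClusterSetTotallyDisconnected`, item stmt-CriticalPhenomena-4659) implies that any two locally
uniform cluster points of the pinned zoom agree off the diagonals (`ClusterPointUnique`, the uniqueness half of the
crux). Proof: the normalised pinned zoom along the harmonic meshes `1/(m+1)` is a tight (`tight_nhdsGT`) and
asymptotically continuous (`tluo_of_ratio`) sequence for the level distances of `exists_levelDist`; every cluster point
of the pinned zoom is one of ITS cluster points (`exists_harmonic_subseq`), and its cluster set, normalised, lies in the
set of item 4659; a separation of that set by open sets of the product topology is a partition of the cluster set into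
parts closed under locally uniform limits, which `clusterSet_partition_false` forbids. [folklore] -/
theorem clusterPointUnique_of_orbitPrecompact_of_totallyDisconnected :
    MonotoneRG.OrbitPrecompact → ClusterRigidity.ClusterSetTotallyDisconnected → ClusterPointUnique := by
  intro hpc htd
  classical
  -- the level distances (support file B)
  obtain ⟨lD, lD_self, lD_comm, lD_triangle, lD_mono, hlc⟩ := exists_levelDist
  -- normalisation: zero off the non-coincident configurations
  set nrm : CorrFamily 3 → CorrFamily 3 := fun S n x => if x ∈ NonCoincident 3 n then S n x else 0 with hnrm
  have nrm_eqOn : ∀ (S : CorrFamily 3) (n : ℕ), Set.EqOn (nrm S n) (S n) (NonCoincident 3 n) := by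
    intro S n x hx
    simp only [hnrm, if_pos hx]
  have nrm_zero : ∀ (S : CorrFamily 3) (n : ℕ) (x : Fin n → EuclideanSpace ℝ (Fin 3)),
      x ∉ NonCoincident 3 n → nrm S n x = 0 := by
    intro S n x hx
    simp only [hnrm, if_neg hx]
  -- the harmonic zoom, normalised
  set y : ℕ → CorrFamily 3 :=
    fun m => nrm (fun n => rescaledCorrelator (criticalCorr 3) rhoPin n (1 / ((m:ℝ) + 1))) with hy
  have ht : Tendsto (fun m : ℕ => 1 / ((m:ℝ) + 1)) atTop (𝓝[>] (0:ℝ)) := tendsto_div_succ_nhdsGT one_pos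
  have hyeq : ∀ (m n : ℕ), Set.EqOn (fun x => rescaledCorrelator (criticalCorr 3) rhoPin n (1 / ((m:ℝ) + 1)) x)
      (y m n) (NonCoincident 3 n) := by
    intro m n x hx
    simp only [hy]
    exact (nrm_eqOn (fun n => rescaledCorrelator (criticalCorr 3) rhoPin n (1 / ((m:ℝ) + 1))) n hx).symm
  -- dictionary: level convergence of `y ∘ φ` ↔ locally uniform convergence of the zoom along `1/(φ k + 1)`
  have hdict : ∀ (φ : ℕ → ℕ) (T : CorrFamily 3),
      (∀ j, Tendsto (fun k => lD j (y (φ k)) T) atTop (𝓝 0)) ↔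
        ∀ n, TendstoLocallyUniformlyOn
          (fun k => rescaledCorrelator (criticalCorr 3) rhoPin n (1 / (((φ k : ℕ) : ℝ) + 1))) (T n) atTop
          (NonCoincident 3 n) := by
    intro φ T
    rw [hlc (fun k => y (φ k)) T]
    exact forall_congr' fun n =>
      ⟨fun h => h.congr fun k => (hyeq (φ k) n).symm, fun h => h.congr fun k => hyeq (φ k) n⟩
  -- (T) tightness of `y`
  have hT : ∀ φ : ℕ → ℕ, StrictMono φ → ∃ ψ : ℕ → ℕ, StrictMono ψ ∧ ∃ T : CorrFamily 3,
      ∀ j, Tendsto (fun k => lD j (y (φ (ψ k))) T) atTop (𝓝 0) := by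
    intro φ hφ
    obtain ⟨ψ, hψ, T, hTc⟩ := tight_nhdsGT hpc (ht.comp hφ.tendsto_atTop)
    exact ⟨ψ, hψ, T, (hdict (φ ∘ ψ) T).2 hTc⟩
  -- (AC) asymptotic continuity of `y`
  have hAC : ∀ j, Tendsto (fun m => lD j (y m) (y (m + 1))) atTop (𝓝 0) := by
    intro j
    refine tendsto_of_subseq_tendsto fun φ₀ hφ₀ => ?_
    obtain ⟨κ, hκ, hmono⟩ := strictMono_subseq_of_tendsto_atTop hφ₀
    obtain ⟨ψ, hψ, T, hTc⟩ := tight_nhdsGT hpc (ht.comp hmono.tendsto_atTop)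
    have hms : StrictMono ((φ₀ ∘ κ) ∘ ψ) := hmono.comp hψ
    have h2 : ∀ n, TendstoLocallyUniformlyOn
        (fun l => rescaledCorrelator (criticalCorr 3) rhoPin n (1 / ((((φ₀ (κ (ψ l)) + 1 : ℕ)) : ℝ) + 1))) (T n)
        atTop (NonCoincident 3 n) := by
      intro n
      refine tluo_of_ratio hpc (u := fun l => 1 / (((φ₀ (κ (ψ l)) : ℕ) : ℝ) + 1))
        (w := fun l => 1 / ((((φ₀ (κ (ψ l)) + 1 : ℕ)) : ℝ) + 1)) ?_ ?_ ?_ hTc n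
      · exact ht.comp hms.tendsto_atTop
      · exact ht.comp ((tendsto_add_atTop_nat 1).comp hms.tendsto_atTop)
      · exact harmonic_ratio_tendsto.comp hms.tendsto_atTop
    have c1 : ∀ j, Tendsto (fun l => lD j (y (φ₀ (κ (ψ l)))) T) atTop (𝓝 0) := (hdict ((φ₀ ∘ κ) ∘ ψ) T).2 hTc
    have c2 : ∀ j, Tendsto (fun l => lD j (y (φ₀ (κ (ψ l)) + 1)) T) atTop (𝓝 0) :=
      (hdict (fun l => φ₀ (κ (ψ l)) + 1) T).2 h2
    exact ⟨κ ∘ ψ, near_of_conv (D := lD) lD_self lD_comm lD_triangle c1 c2 j⟩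
  -- the cluster set of `y` and its normalised image
  set C : Set (CorrFamily 3) :=
    {T | ∃ φ : ℕ → ℕ, StrictMono φ ∧ ∀ j, Tendsto (fun k => lD j (y (φ k)) T) atTop (𝓝 0)} with hC
  have hCiff : ∀ T, T ∈ C ↔ ∃ φ : ℕ → ℕ, StrictMono φ ∧ ∀ j, Tendsto (fun k => lD j (y (φ k)) T) atTop (𝓝 0) :=
    fun T => Iff.rfl
  set K : Set (CorrFamily 3) := nrm '' C with hK
  -- `K` lies in the set of item 4659
  have hKsub : K ⊆ {S : CorrFamily 3 | (∀ n x, x ∉ NonCoincident 3 n → S n x = 0) ∧ ∃ u : ℕ → ℝ,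
      (∀ k, u k ∈ Set.Ioc (0:ℝ) 1) ∧ Tendsto u atTop (nhds 0) ∧ ∀ n, TendstoLocallyUniformlyOn
        (fun k => rescaledCorrelator (criticalCorr 3)
          (fun δ : ℝ => (criticalTwoPoint 3 (Pi.single 0 ⌊δ⁻¹⌋)) ^ (-(1/2:ℝ))) n (u k))
        (S n) atTop (NonCoincident 3 n)} := by
    rintro _ ⟨T, ⟨φ, hφ, hTc⟩, rfl⟩
    refine ⟨fun n x hx => nrm_zero T n x hx, fun k => 1 / (((φ k : ℕ) : ℝ) + 1),
      fun k => one_div_succ_mem_Ioc _, (tendsto_nhdsWithin_iff.1 (ht.comp hφ.tendsto_atTop)).1, fun n => ?_⟩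
    rw [rhoStar_eq_rhoPin]
    exact (((hdict φ T).1 hTc) n).congr_right (nrm_eqOn T n).symm
  -- pointwise convergence of normalised families from level convergence
  have hptw : ∀ (a : ℕ → CorrFamily 3) (T : CorrFamily 3),
      (∀ j, Tendsto (fun k => lD j (a k) T) atTop (𝓝 0)) → Tendsto (fun k => nrm (a k)) atTop (𝓝 (nrm T)) := by
    intro a T ha
    rw [tendsto_pi_nhds]
    intro n
    rw [tendsto_pi_nhds]
    intro x
    by_cases hx : x ∈ NonCoincident 3 n
    · have h1 := (((hlc a T).1 ha) n).tendsto_at hx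
      simp only [hnrm, if_pos hx]
      exact h1
    · simp only [hnrm, if_neg hx]
      exact tendsto_const_nhds
  -- the two cluster points
  intro S S' hS hS'
  have hmem : ∀ {T : CorrFamily 3}, IsClusterPoint T → T ∈ C := by
    intro T hT
    obtain ⟨φ, hφ, hconv⟩ := exists_harmonic_subseq hpc T hT
    exact ⟨φ, hφ, (hdict φ T).2 hconv⟩
  have hSK : nrm S ∈ K := ⟨S, hmem hS, rfl⟩
  have hS'K : nrm S' ∈ K := ⟨S', hmem hS', rfl⟩
  suffices heq : nrm S = nrm S' by
    intro n x hx
    rw [← nrm_eqOn S n hx, ← nrm_eqOn S' n hx, heq]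
  by_contra hne
  -- `K` is totally disconnected (item 4659) and has two points, hence is not preconnected
  have hnp : ¬ IsPreconnected K := fun hp => hne (htd K hKsub hp hSK hS'K)
  obtain ⟨U, V, hU, hV, hKUV, hKU, hKV, hKUVe⟩ : ∃ U V : Set (CorrFamily 3), IsOpen U ∧ IsOpen V ∧
      K ⊆ U ∪ V ∧ (K ∩ U).Nonempty ∧ (K ∩ V).Nonempty ∧ ¬ (K ∩ (U ∩ V)).Nonempty := by
    by_contra h
    apply hnp
    intro U V hU hV hKUV hKU hKV
    by_contra h'
    exact h ⟨U, V, hU, hV, hKUV, hKU, hKV, h'⟩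
  have hdis : ∀ Z ∈ K, Z ∈ U → Z ∉ V := fun Z hZ hZU hZV => hKUVe ⟨Z, hZ, hZU, hZV⟩
  -- closure of the two parts under limits from the cluster set
  have hcl : ∀ {W W' : Set (CorrFamily 3)}, K ⊆ W ∪ W' → IsOpen W' → (∀ Z ∈ K, Z ∈ W → Z ∉ W') →
      ∀ (a : ℕ → CorrFamily 3) (T : CorrFamily 3), (∀ k, a k ∈ C ∧ nrm (a k) ∈ W) → T ∈ C →
        (∀ j, Tendsto (fun k => lD j (a k) T) atTop (𝓝 0)) → nrm T ∈ W := by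
    intro W W' hKWW' hW' hdis' a T ha hTC haT
    have hTK : nrm T ∈ K := ⟨T, hTC, rfl⟩
    rcases hKWW' hTK with h | h
    · exact h
    · exfalso
      have hev : ∀ᶠ k in atTop, nrm (a k) ∈ W' := (hptw a T haT).eventually (hW'.mem_nhds h)
      obtain ⟨k, hk⟩ := hev.exists
      exact hdis' _ ⟨a k, (ha k).1, rfl⟩ (ha k).2 hk
  -- the abstract connectedness theorem (support file A)
  refine clusterSet_partition_false (D := lD) lD_self lD_comm lD_triangle lD_mono hT hAC hCiff
    (A := {T | T ∈ C ∧ nrm T ∈ U}) (B := {T | T ∈ C ∧ nrm T ∈ V})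
    (fun T hT => hT.1) (fun T hT => hT.1) ?_ ?_ ?_ ?_ ?_ ?_
  · intro T hT
    rcases hKUV ⟨T, hT, rfl⟩ with h | h
    · exact Or.inl ⟨hT, h⟩
    · exact Or.inr ⟨hT, h⟩
  · intro T hTA hTB
    exact hdis _ ⟨T, hTA.1, rfl⟩ hTA.2 hTB.2
  · intro a T ha hTC haT
    exact ⟨hTC, hcl hKUV hV hdis a T ha hTC haT⟩
  · intro b T hb hTC hbT
    exact ⟨hTC, hcl (W := V) (W' := U) (fun Z hZ => (hKUV hZ).symm) hU
      (fun Z hZ hZV hZU => hdis Z hZ hZU hZV) b T hb hTC hbT⟩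
  · obtain ⟨_, ⟨T, hT, rfl⟩, hTU⟩ := hKU
    exact ⟨T, hT, hTU⟩
  · obtain ⟨_, ⟨T, hT, rfl⟩, hTV⟩ := hKV
    exact ⟨T, hT, hTV⟩

/-- **`ClusterPointUnique` ⟹ item 4659** (unconditionally; the conclusion is the body of
`ClusterRigidity.ClusterSetTotallyDisconnected`, verbatim): if any two cluster points agree off the diagonals, the
cluster set of the self-normalised family is a subsingleton, hence totally disconnected. [folklore] -/
theorem clusterSetTotallyDisconnected_of_clusterPointUnique (h : ClusterPointUnique) :
    IsTotallyDisconnected {S : CorrFamily 3 | (∀ n x, x ∉ NonCoincident 3 n → S n x = 0) ∧ ∃ u : ℕ → ℝ,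
      (∀ k, u k ∈ Set.Ioc (0:ℝ) 1) ∧ Tendsto u atTop (nhds 0) ∧ ∀ n, TendstoLocallyUniformlyOn
        (fun k => rescaledCorrelator (criticalCorr 3)
          (fun δ : ℝ => (criticalTwoPoint 3 (Pi.single 0 ⌊δ⁻¹⌋)) ^ (-(1/2:ℝ))) n (u k))
        (S n) atTop (NonCoincident 3 n)} := by
  intro t ht _ T hT T' hT'
  obtain ⟨hTn, u, hu1, hu0, hTc⟩ := ht hT
  obtain ⟨hT'n, u', hu1', hu0', hT'c⟩ := ht hT'
  rw [rhoStar_eq_rhoPin] at hTc hT'c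
  have hu : Tendsto u atTop (𝓝[>] (0:ℝ)) :=
    tendsto_nhdsWithin_iff.2 ⟨hu0, Eventually.of_forall fun k => (hu1 k).1⟩
  have hu' : Tendsto u' atTop (𝓝[>] (0:ℝ)) :=
    tendsto_nhdsWithin_iff.2 ⟨hu0', Eventually.of_forall fun k => (hu1' k).1⟩
  have heq := h T T' ⟨u, hu, hTc⟩ ⟨u', hu', hT'c⟩
  funext n x
  by_cases hx : x ∈ NonCoincident 3 n
  · exact heq n hx
  · rw [hTn n x hx, hT'n n x hx]

/-- **Under item 5955, the uniqueness half IS item 4659**: `ClusterPointUnique ⟺ ClusterSetTotallyDisconnected`.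
[folklore] -/
theorem clusterPointUnique_iff_clusterSetTotallyDisconnected (hpc : MonotoneRG.OrbitPrecompact) :
    ClusterPointUnique ↔ ClusterRigidity.ClusterSetTotallyDisconnected :=
  ⟨clusterSetTotallyDisconnected_of_clusterPointUnique,
    clusterPointUnique_of_orbitPrecompact_of_totallyDisconnected hpc⟩

/-- **Item 6150 ∧ item 4659 ⟹ `ClusterPointUnique`** (the form consumed by the skeleton, whose other half is item 6150
`TwoPointDoubling` ⟺ 5955, `orbitPrecompact_iff_doubling`). [folklore] -/
theorem clusterPointUnique_of_doubling_of_totallyDisconnected :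
    MirrorHoelderCompactness.TwoPointDoubling → ClusterRigidity.ClusterSetTotallyDisconnected → ClusterPointUnique :=
  fun hD htd =>
    clusterPointUnique_of_orbitPrecompact_of_totallyDisconnected (orbitPrecompact_iff_doubling.2 hD) htd

/-- **THE CRUX IS ITEM 6150 ∧ ITEM 4659**: existence of the scale-covariant continuum limit of all critical `ℤ³` Ising
correlators ⟺ all-scale doubling of the axial two-point function (`MirrorHoelderCompactness.TwoPointDoubling`) ∧ total
disconnectedness of the cluster set of the self-normalised correlators (`ClusterRigidity.ClusterSetTotallyDisconnected`).
[folklore] -/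
theorem crux_iff_doubling_and_totallyDisconnected :
    HyperoctahedralRP.ExistsScaleCovariantLimit ↔
      MirrorHoelderCompactness.TwoPointDoubling ∧ ClusterRigidity.ClusterSetTotallyDisconnected := by
  rw [crux_iff_orbitPrecompact_and_unique, orbitPrecompact_iff_doubling]
  constructor
  · rintro ⟨hD, hU⟩
    exact ⟨hD, clusterSetTotallyDisconnected_of_clusterPointUnique hU⟩
  · rintro ⟨hD, htd⟩
    exact ⟨hD, clusterPointUnique_of_doubling_of_totallyDisconnected hD htd⟩

/-- **Item 6153 ⟹ `ClusterPointUnique`** (`MirrorHoelderCompactness.PointwiseLimit`, pointwise full-filter convergence;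
the landed `clusterPoint_eqOn_of_pointwiseLimit`). [folklore] -/
theorem clusterPointUnique_of_pointwiseLimit (h : MirrorHoelderCompactness.PointwiseLimit) :
    ClusterPointUnique :=
  clusterPoint_eqOn_of_pointwiseLimit h

/-- **crux ⟹ `ClusterPointUnique`** (`crux_iff_orbitPrecompact_and_unique`). [folklore] -/
theorem clusterPointUnique_of_crux (h : HyperoctahedralRP.ExistsScaleCovariantLimit) : ClusterPointUnique :=
  (crux_iff_orbitPrecompact_and_unique.1 h).2

end Main

end Summit.CriticalPhenomena.Ising3DConformalLimit.Cruxes.ExistsScaleCovariantLimit.FoldedCurrentRepulsion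

end
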